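import Literature.MathematicalPhysics.QuantumFieldTheory.YangMillsOS
import Literature.MathematicalPhysics.QuantumLattice.LatticeGaugeDLRGibbsProofs
import Literature.Probability.LatticeModels.GibbsSpecification
import Summits.QuantumFields.YangMills.Theses.CertificationLength
import Summits.QuantumFields.YangMills.Theorems.ContractibleFibreFibreToTorusTranslationInvariantUniquenessOfCA
import Summits.QuantumFields.YangMills.Theorems.ConvexGribovBodyNonSimplyConnectedLatticeGapStubDlrGaugeInvariant
import Summits.QuantumFields.YangMills.Theorems.ConvexGribovBodyNonSimplyConnectedLatticeGapStubDlrEqOfGaugeInvariantAgreement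
import HarnessLib

/-!
# (EXT) `ExtremalInvariantStates` ⇐ DLR uniqueness ⇐ gauge-invariant uniqueness ⇐ complete analyticity
# (reductions for stub `stub_extremalInvariantStates` of line `replica-rooting`, crux `HyperbolicToTorusR`)

Stub (EXT) of crux `Summit.QuantumFields.YangMills.Theses.HyperbolicRegulator.HyperbolicToTorusR`
(stmt-QuantumFields-18156), registered skeleton `Cruxes/HyperbolicToTorusR/Lines/replica_rooting.lean`
(sha `c79b3092…`): for every compact simple `G` and faithful unitary `r` there is `β_e` such that at every
`β ≥ β_e` every `ℤ⁴`-translation-invariant DLR state of Wilson's specification `ymSpecification r.ρ β` is an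
extremal Gibbs state (`IsExtremalGibbs γ μ := μ ∈ Set.extremePoints ℝ≥0∞ (gibbsMeasures γ)`).

HONEST STATUS: (EXT) is purity (and, by the refuter's `Theorems/HyperbolicToTorusR/Negative/
ExtremalInvariantStatesStrength.lean`, uniqueness) of the homogeneous phase of 4-d lattice Yang–Mills theory at
weak coupling — an OPEN PROBLEM; no weak-coupling engine exists in the tree other than the OPEN item
`CertificationLength.CompleteAnalyticityAtLargeScales` (stmt-QuantumFields-16178, the Dobrushin–Shlosman
finite-size condition at arbitrarily large scales).  This file records the kernel-checked REDUCTIONS, all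
elementary:

* `isExtremalGibbs_of_subsingleton` — for any specification `γ`, a member of a subsingleton `𝒢(γ)` is an
  extreme point of `𝒢(γ)` (Mathlib `Set.extremePoints`, definitionally).
* `subsingleton_ymGibbsMeasures_of_forall_integral_eq` — at fixed `β`: if all DLR states of
  `ymSpecification ρ β` agree on every gauge-invariant local observable (`LocalGaugeObservable 4 G`), then
  `𝒢(β)` is a subsingleton.  Every DLR state is gauge invariant (landed `stub_dlr_gaugeInvariant`, Elitzur in
  DLR form) and two gauge-invariant DLR states agreeing on gauge-invariant local observables are equal (landed
  `stub_dlr_eq_of_gaugeInvariantAgreement`, gauge averaging + π-system of measurable cylinders).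
* `extremalInvariantStates_of_subsingleton` — (a) "`∃ βe ∀ β ≥ βe`, `𝒢(β)` subsingleton" ⇒ (EXT), VERBATIM the
  registered signature (the translation-invariance hypothesis is not used).
* `subsingletonAtLargeBeta_of_gaugeInvariantUniqueness`, `extremalInvariantStates_of_gaugeInvariantUniqueness`
  — (b) U ⇒ (EXT), where U is VERBATIM line `uniqueness`'s `GaugeInvariantUniqueness` (the hypothesis of the
  landed `FibreToTorus.translationInvariantUniqueness_of_gaugeInvariantUniqueness`): all DLR states agree on
  `YMSpecies` at `β ≥ β_u`.
* `extremalInvariantStates_of_completeAnalyticityAtLargeScales` — (c) CA ⇒ (EXT), through the landed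
  `FibreToTorus.gaugeInvariantUniqueness_of_completeAnalyticityAtLargeScales` (CA ⇒ U).

So on line `replica-rooting` the stub (EXT) is `stub-blocked` on `CompleteAnalyticityAtLargeScales` exactly like
the sibling's U / U_tr / NS stubs; nothing weaker than (EXT) is asserted here and no statement of the route is
claimed.  Georgii 2011 Ch. 7 (extremal Gibbs measures, Thm. 7.7), Friedli–Velenik 2017 Def. 6.57 / Thm. 6.58 for
the notions; Seiler LNP 159 Ch. 2 for gauge invariance of DLR states.
-/

noncomputable section

open scoped ENNReal
open MeasureTheory
open Literature.MathematicalPhysics.QuantumFieldTheory (LatticeRep YMSpecies IsCompactSimpleLieGroup)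
open Literature.Probability.LatticeModels (IsExtremalGibbs gibbsMeasures Specification)
open Literature.MathematicalPhysics.QuantumLattice (LGConfig ZdEdge IsZdTranslationInvariant LocalGaugeObservable
  ymSpecification ymGibbsMeasures gaugeTransformZd)
open Summit.QuantumFields.YangMills.Theorems.NonSimplyConnectedLatticeGap (stub_dlr_gaugeInvariant
  stub_dlr_eq_of_gaugeInvariantAgreement)

namespace Summit.QuantumFields.YangMills.Theorems.HyperbolicToTorusR

/-! ## Abstract: uniqueness implies extremality -/

/-- **A member of a subsingleton `𝒢(γ)` is an extremal Gibbs measure** (any specification `γ` on any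
configuration space): the endpoints of an open segment through `μ` inside `𝒢(γ)` equal `μ` because `𝒢(γ)`
has at most one element. [folklore] -/
theorem isExtremalGibbs_of_subsingleton {V S : Type*} [MeasurableSpace S] (γ : Specification V S)
    (h : (gibbsMeasures γ).Subsingleton) {μ : Measure (V → S)} (hμ : μ ∈ gibbsMeasures γ) :
    IsExtremalGibbs γ μ :=
  ⟨hμ, fun _ h₁ _ _ _ => h h₁ hμ⟩

/-! ## Fixed coupling: gauge-invariant uniqueness ⇒ `𝒢(β)` subsingleton ⇒ extremality -/

section FixedBeta

variable {N : ℕ} {G : Type} [Group G] [TopologicalSpace G] [IsTopologicalGroup G] [CompactSpace G]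
  [MeasurableSpace G] [BorelSpace G]

/-- **`𝒢(β)` subsingleton ⇒ every DLR state of `ymSpecification ρ β` is extremal** (in particular every
translation-invariant one). [folklore] -/
theorem isExtremalGibbs_of_subsingleton_ymGibbsMeasures (ρ : G →* Matrix (Fin N) (Fin N) ℂ) (β : ℝ)
    (h : (ymGibbsMeasures (d := 4) ρ β).Subsingleton) {μ : Measure (LGConfig 4 G)}
    (hμ : μ ∈ ymGibbsMeasures (d := 4) ρ β) : IsExtremalGibbs (ymSpecification (d := 4) ρ β) μ :=
  isExtremalGibbs_of_subsingleton _ h hμ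

/-- **Gauge-invariant uniqueness at `β` ⇒ `𝒢(β)` is a subsingleton** (compact metrisable `G`, continuous
`ρ`): if all DLR states of `ymSpecification ρ β` have equal expectations of every gauge-invariant local
observable, any two of them coincide — both are gauge invariant (`stub_dlr_gaugeInvariant`) and gauge-invariant
DLR states are determined by the gauge-invariant local observables (`stub_dlr_eq_of_gaugeInvariantAgreement`).
[folklore] -/
theorem subsingleton_ymGibbsMeasures_of_forall_integral_eq [SecondCountableTopology G] [T2Space G]
    (ρ : G →* Matrix (Fin N) (Fin N) ℂ) (hρ : Continuous ρ) (β : ℝ)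
    (hU : ∀ μ ν : Measure (LGConfig 4 G), μ ∈ ymGibbsMeasures (d := 4) ρ β →
      ν ∈ ymGibbsMeasures (d := 4) ρ β → ∀ A : LocalGaugeObservable 4 G, ∫ U, A.F U ∂μ = ∫ U, A.F U ∂ν) :
    (ymGibbsMeasures (d := 4) ρ β).Subsingleton := fun μ hμ ν hν =>
  stub_dlr_eq_of_gaugeInvariantAgreement G N ρ hρ β μ ν hμ hν (stub_dlr_gaugeInvariant G N ρ hρ β μ hμ)
    (stub_dlr_gaugeInvariant G N ρ hρ β ν hν) (hU μ ν hμ hν)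

/-- **Gauge-invariant uniqueness at `β` ⇒ every DLR state at `β` is extremal** (composite of the two lemmas
above). [folklore] -/
theorem isExtremalGibbs_of_forall_integral_eq [SecondCountableTopology G] [T2Space G]
    (ρ : G →* Matrix (Fin N) (Fin N) ℂ) (hρ : Continuous ρ) (β : ℝ)
    (hU : ∀ μ ν : Measure (LGConfig 4 G), μ ∈ ymGibbsMeasures (d := 4) ρ β →
      ν ∈ ymGibbsMeasures (d := 4) ρ β → ∀ A : LocalGaugeObservable 4 G, ∫ U, A.F U ∂μ = ∫ U, A.F U ∂ν)
    {μ : Measure (LGConfig 4 G)} (hμ : μ ∈ ymGibbsMeasures (d := 4) ρ β) :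
    IsExtremalGibbs (ymSpecification (d := 4) ρ β) μ :=
  isExtremalGibbs_of_subsingleton_ymGibbsMeasures ρ β (subsingleton_ymGibbsMeasures_of_forall_integral_eq ρ hρ β hU)
    hμ

end FixedBeta

/-! ## Skeleton level: (EXT) from uniqueness statements, verbatim signatures -/

/-- **(a) DLR uniqueness at weak coupling ⇒ (EXT).**  If for every compact simple `G` and faithful unitary `r`
the set `𝒢(β)` of DLR states of `ymSpecification r.ρ β` is a subsingleton for all `β ≥ β_e`, then the registered
stub statement `ExtremalInvariantStates` holds (conclusion VERBATIM the registered signature of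
`stub_extremalInvariantStates`; translation invariance is not used). [folklore] -/
theorem extremalInvariantStates_of_subsingleton
    (h : ∀ (G : Type) [Group G] [TopologicalSpace G] [IsTopologicalGroup G] [CompactSpace G]
      [MeasurableSpace G] [BorelSpace G], IsCompactSimpleLieGroup G → ∀ r : LatticeRep G,
      ∃ βe : ℝ, ∀ β : ℝ, βe ≤ β → (ymGibbsMeasures (d := 4) r.ρ β).Subsingleton) :
    ∀ (G : Type) [Group G] [TopologicalSpace G] [IsTopologicalGroup G] [CompactSpace G]
      [MeasurableSpace G] [BorelSpace G], IsCompactSimpleLieGroup G → ∀ r : LatticeRep G,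
      ∃ βe : ℝ, ∀ β : ℝ, βe ≤ β → ∀ μ : MeasureTheory.Measure (LGConfig 4 G),
        μ ∈ ymGibbsMeasures r.ρ β → IsZdTranslationInvariant μ →
          IsExtremalGibbs (ymSpecification r.ρ β) μ := by
  intro G _ _ _ _ _ _ hG r
  obtain ⟨βe, hβe⟩ := h G hG r
  exact ⟨βe, fun β hβ μ hμ _ => isExtremalGibbs_of_subsingleton_ymGibbsMeasures r.ρ β (hβe β hβ) hμ⟩

/-- **U ⇒ DLR uniqueness at weak coupling.**  The hypothesis is VERBATIM line `uniqueness`'s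
`GaugeInvariantUniqueness` (all DLR states agree on every `YMSpecies G` at `β ≥ β_u`, the hypothesis of the
landed `FibreToTorus.translationInvariantUniqueness_of_gaugeInvariantUniqueness`); the conclusion is the
hypothesis of `extremalInvariantStates_of_subsingleton` with `β_e := β_u`.  `G` is Hausdorff and second countable
because `r.ρ` is a closed embedding into a matrix space. [folklore] -/
theorem subsingletonAtLargeBeta_of_gaugeInvariantUniqueness
    (hU : ∀ (G : Type) [Group G] [TopologicalSpace G] [IsTopologicalGroup G] [CompactSpace G]
      [MeasurableSpace G] [BorelSpace G], IsCompactSimpleLieGroup G → ∀ r : LatticeRep G,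
      ∃ βu : ℝ, ∀ β : ℝ, βu ≤ β → ∀ μ ν : MeasureTheory.Measure (LGConfig 4 G),
        μ ∈ ymGibbsMeasures (d := 4) r.ρ β → ν ∈ ymGibbsMeasures (d := 4) r.ρ β →
          ∀ A : YMSpecies G, ∫ U, A.F U ∂μ = ∫ U, A.F U ∂ν) :
    ∀ (G : Type) [Group G] [TopologicalSpace G] [IsTopologicalGroup G] [CompactSpace G]
      [MeasurableSpace G] [BorelSpace G], IsCompactSimpleLieGroup G → ∀ r : LatticeRep G,
      ∃ βe : ℝ, ∀ β : ℝ, βe ≤ β → (ymGibbsMeasures (d := 4) r.ρ β).Subsingleton := by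
  intro G _ _ _ _ _ _ hG r
  haveI : T2Space G := (r.continuous.isClosedEmbedding r.injective).isEmbedding.t2Space
  haveI : SecondCountableTopology G :=
    (r.continuous.isClosedEmbedding r.injective).isEmbedding.secondCountableTopology
  obtain ⟨βu, hβu⟩ := hU G hG r
  exact ⟨βu, fun β hβ => subsingleton_ymGibbsMeasures_of_forall_integral_eq r.ρ r.continuous β (hβu β hβ)⟩

/-- **(b) U ⇒ (EXT)**: gauge-invariant uniqueness at weak coupling (VERBATIM `GaugeInvariantUniqueness`) implies
the registered stub statement `ExtremalInvariantStates` (VERBATIM). [folklore] -/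
theorem extremalInvariantStates_of_gaugeInvariantUniqueness
    (hU : ∀ (G : Type) [Group G] [TopologicalSpace G] [IsTopologicalGroup G] [CompactSpace G]
      [MeasurableSpace G] [BorelSpace G], IsCompactSimpleLieGroup G → ∀ r : LatticeRep G,
      ∃ βu : ℝ, ∀ β : ℝ, βu ≤ β → ∀ μ ν : MeasureTheory.Measure (LGConfig 4 G),
        μ ∈ ymGibbsMeasures (d := 4) r.ρ β → ν ∈ ymGibbsMeasures (d := 4) r.ρ β →
          ∀ A : YMSpecies G, ∫ U, A.F U ∂μ = ∫ U, A.F U ∂ν) :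
    ∀ (G : Type) [Group G] [TopologicalSpace G] [IsTopologicalGroup G] [CompactSpace G]
      [MeasurableSpace G] [BorelSpace G], IsCompactSimpleLieGroup G → ∀ r : LatticeRep G,
      ∃ βe : ℝ, ∀ β : ℝ, βe ≤ β → ∀ μ : MeasureTheory.Measure (LGConfig 4 G),
        μ ∈ ymGibbsMeasures r.ρ β → IsZdTranslationInvariant μ →
          IsExtremalGibbs (ymSpecification r.ρ β) μ :=
  extremalInvariantStates_of_subsingleton (subsingletonAtLargeBeta_of_gaugeInvariantUniqueness hU)

/-- **(c) CA ⇒ (EXT)**: the Dobrushin–Shlosman finite-size condition at arbitrarily large scales (item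
stmt-QuantumFields-16178, `CertificationLength.CompleteAnalyticityAtLargeScales`, OPEN) implies the registered
stub statement `ExtremalInvariantStates` (VERBATIM), through the landed CA ⇒ U
(`FibreToTorus.gaugeInvariantUniqueness_of_completeAnalyticityAtLargeScales`) and (b). [folklore] -/
theorem extremalInvariantStates_of_completeAnalyticityAtLargeScales
    (h : Summit.QuantumFields.YangMills.Theses.CertificationLength.CompleteAnalyticityAtLargeScales) :
    ∀ (G : Type) [Group G] [TopologicalSpace G] [IsTopologicalGroup G] [CompactSpace G]
      [MeasurableSpace G] [BorelSpace G], IsCompactSimpleLieGroup G → ∀ r : LatticeRep G,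
      ∃ βe : ℝ, ∀ β : ℝ, βe ≤ β → ∀ μ : MeasureTheory.Measure (LGConfig 4 G),
        μ ∈ ymGibbsMeasures r.ρ β → IsZdTranslationInvariant μ →
          IsExtremalGibbs (ymSpecification r.ρ β) μ :=
  extremalInvariantStates_of_gaugeInvariantUniqueness
    (Summit.QuantumFields.YangMills.Theorems.FibreToTorus.gaugeInvariantUniqueness_of_completeAnalyticityAtLargeScales
      h)

end Summit.QuantumFields.YangMills.Theorems.HyperbolicToTorusR

end
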